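import Literature.MathematicalPhysics.QuantumFieldTheory.Balaban1983to89.Node00.Record11CarriersB12

/-!
# NODE 00 (YM-PLAN Track A) — STAGE 3′(X.B12), COMPANION: THE DISPLAYED BY-REFERENCE PACKAGE OF LEMMA 4 AT THE DATA OF RECORD (`B12Package`),
# `lemma4DataOfRecord`, `frameOf_lemma4DataOfRecord : rfl`, AND THE KNIT FACE `b12LeafOfRecord_of_package` = lit-balaban p07's `lemma4Printed_frameOf` BY NAME;
# its Stage-11 and record-level forms (companion of node00-def g32's `Node00/CarriersB12` p453948 ∕ `Node00/Record11CarriersB12` p454379)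

NODE 00 COMPANION MODULE (seat `pub-ymgap-node00-def-B12` g0, 2026-08-26; director-ym R141 (A) row + LINE №72 (3) «one pen per file: g32 = carriers ∕ index ∕ residual ∕ leaf,
B12 seat = the knit-face module»; START-HERE = node00-def g32's kernel-checked draft `HOME/pub-ymgap-node00-def/lean/g32/Node00/CarriersB12Package.draft.lean` (AMEND-23,
pub-ymgap INBOX l.12371), decl names kept verbatim so that the N09 seats' INTENT lines (dag-n09-c g2, dag-n09-d g2) resolve).  APPEND-ONLY: a NEW importing module; g32's two
modules, def-T's `Record11` ∕ 11b `Sect2FrameOfRecord`, lit-balaban p07's `B12Lemma4ConcreteFrame`, r20's `B12Lemma4Models` ∕ `B12Eq311Models` and pub-balaban's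
`B12RegularSpaces111SpecialUnitary` untouched and CONSUMED BY NAME.  [Balaban1987RG1] = T. Bałaban, *Renormalization group approach to lattice gauge field theories. I*,
Commun. Math. Phys. **109** (1987) 249–301; [15] = [Balaban1985Variational], Commun. Math. Phys. **102** (1985) 277–309.

WHAT IS DEFINED ∕ PROVED (kernel bookkeeping, 0 sorry).  §A: `B12Package Rz cB lam` — a `Type`-valued HYPOTHESIS structure (p07's `JInputs` carries the [15]-functions as
DATA, so the package cannot be a `Prop`) displaying EXACTLY the law-fields of p07's `Lemma4Data` that are NOT theorems for the objects of record: the seven further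
restrictions on the constants (with `Cπ = 2`), the seven region inclusions of print's fundamental case `X ⊂ □̃² ⊂ Y = □̃³ ⊂ (□̃⁵)^{∼−2}` read on 11b's `regionOfSet`
(finite torus combinatorics — dag-n09-c g2's `Node00/Sect2RegionGeometry` p455158 is typed to discharge them at `IdxB12.boxT ∕ XSites`; displayed here), THE `JInputs`
PACKAGE for every value of the variables `(𝐔, 𝐀, τ, B′)` in the printed domain, and the analyticity of the letters `𝐊`, `𝐀₂`; `lemma4DataOfRecord` — p07's `Lemma4Data`
at the objects of record with the eleven scale fields (`ξ = L⁻ʲ`, `η = L⁻ᵏ`, `L^jξ = 1`, `L^jη ≤ 1` for `j ≤ k`, `ξ·L^{j−1}η = L⁻¹η`, `ξ′ = L⁻¹η`, …: arithmetic on `Params.eta`)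
and the six model ∕ projection fields (r20's `suModel_heGc`, `slProj_mem_suModel_gc`, `suModel_hgc_Gc`, `slProj_conj`, `B12Eq311Models.norm_slProj_le`, `Cπ = 2 ≥ 0`) PROVED;
`frameOf_lemma4DataOfRecord : frameOf (suModel N) lam.consts (lemma4DataOfRecord …) = F12OfRecord Rz cB lam` (`rfl` — p07's concrete frame reads the data fields only);
THE KNIT FACE `b12LeafOfRecord_of_package : B12Package Rz cB lam → B12LeafOfRecord Rz cB lam` = p07's `lemma4Printed_frameOf` BY NAME (membership by
`B12Lemma4Assembled.ofBackground_mem_space'_lemma4_of_upper_space`, analyticity by `B12CondIIIJConcreteModels.analyticAt_pair_lemma4`).  §B: the same at a Stage-11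
parameter (`b12LeafOfRecord₁₁_of_package`, `0 < O(1)LMB` from admissibility) and at a record of g32's `IsRecordOfRecord₁₁CB10YZWB8B12` in package form
(`b12_leaf_of_isRecordOfRecord₁₁CB10YZWB8B12_of_package`, through g32's slots form).

WHAT THIS IS NOT.  Not a discharge of N09: `B12Package` is a hypothesis — its `inputs` field IS the content of pp. 275–280 ([15]'s Landau-gauge functions, the gauge
transformations (3.37)–(3.42) with their costs, the identities (3.38)∕(3.39)∕(3.42) and the sizes (3.37), (3.45), (3.50), (J2), (J3)) for the residual letters `𝐊`, `𝐀₂`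
of record, which have NO tree object (A's header; seat n09-b's `B12Lemma4ChartSizes` derives the SIZES for the abstract chart `B11Eq174Chart.chartH`); hence ANY `slot12`
reached through a `B12Package` is GAP-STATED(package), and a package whose letters are junk (`𝐊 = 𝐀₂ = 0`: the composite is the unit pair) or whose class is empty
(`A331 = ∅`: the ∀ is vacuous) or whose restrictions are unsatisfiable says nothing — a count line at a record must DISPLAY `0 ∈ lam.A331` (p.277 «At first let us take A = 0»),
satisfiable `Lemma4Restrictions lam.consts` and the letters of print (ref-C READ-115 (B4)).  READING NOTES inherited from p07's frame (ref-C (B5)–(B7), located, not blocking):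
`Uprime` checks (i)–(iv) on `□̃⁵` only (print asks (i)–(iii) on all of `T_η`), so the typed hypothesis class is LARGER than print's `U′` and the field `inputs` must be supplied
on that larger class; the instance cube is an `M`-cube of `T⁽ᵏ⁺¹⁾` (print: unions of `2^d` cubes of `π_k` — identical iff `L = 2`, the size factor sits in `O₁`); `|B′| := ‖B′‖`
over all bonds (print: the bonds of `U_j(□₀, ·)`; identical for `B′` extended by `0`).  LOCATED (SAID, as in A): the leaf reads ONE instance `(k, j, □, X) = lam.idx` per run; the family form of print's Lemma 4 over ONE schematic frame is the successor device `frameOfFamily` of the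
sibling module `Node00/CarriersB12Family` (this seat).  HONEST FRAMING: definitions + kernel bookkeeping; NO estimate; nothing of [Balaban1987RG1] ∕ [15] asserted; counts
unmoved (5∕28); one finite T⁴ programme at fixed ε — NOT continuum ∕ ℝ⁴ ∕ infinite volume ∕ OS ∕ mass gap ∕ Clay.  No `sorry`, no `axiom`, no `opaque`, no `instance`,
no `notation`. -/

noncomputable section

namespace Literature.MathematicalPhysics.QuantumFieldTheory.Balaban1983to89.Node00

open T4Continuum AveragingRT T4FiniteEpsInhabited FlowStep FlowStepRuns DagBinding T4DatumAssembly
open B12RegularSpaces111 (Frame Region StepConsts space space' expI grad CondIV)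
open B12Eq18Current (ofBackground current)
open B12Lemma4ConcreteFrame (JInputs Lemma4Data frameOf LettersAnalyticAt lemma4Printed_frameOf)
open B12Lemma4Models (slProj slProj_mem_suModel_gc suModel_heGc suModel_hgc_Gc slProj_conj)
open B12RegularSpaces111SpecialUnitary (suModel)
open B12Eq311CurrentExpansion (C311)
open Step B14DomainGeom B14.Eq213MaximalDomains B15Eq112TorusCover TreeLengthTorus
open scoped Matrix.Norms.L2Operator

/-! ## §A. The displayed by-reference package, `lemma4DataOfRecord`, the knit face -/

section Package

variable {P : Params} {N M : ℕ}

/-- **THE DISPLAYED BY-REFERENCE PACKAGE of Lemma 4 at the data of record** (a `Type`: the `JInputs` carry the [15]-functions as data) — exactly the law-fields of p07's `Lemma4Data` that are NOT theorems for the objects of record: the seven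
further restrictions on the constants (`Cπ = 2`); the seven region inclusions of the fundamental case (`X ⊂ □̃² ⊂ Y = □̃³ ⊂ (□̃⁵)^{∼−2}`, finite torus combinatorics, displayed);
THE BY-REFERENCE PACKAGE `JInputs` ([15], [14]: the upper-space datum (3.40), `𝐇_j(□₀, Q(…))`, `H_{1,j}`, `ℓ`, the gauge transformations with their costs, the identities
(3.39)+(3.37) ∕ (3.42) ∕ (3.38)×2 and the sizes (3.37), (3.45)×2, (3.50), (J2)×2, (J3)) for every value of the variables in the printed domain; the analyticity of the letters
`𝐊`, `𝐀₂` along analytic families (p. 276 «explicitly given analytic functions of 𝐔»).  A HYPOTHESIS structure; nothing printed is asserted.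
[cite: Balaban1987RG1, (3.26)–(3.52) pp.275–280, Lemma 4 p.280; Balaban1985Variational, (174)–(177) pp.305–306, Prop. 9 p.309] -/
structure B12Package (Rz : Sect2.Residual P (MatA N)) (cB : ℝ) (lam : ResidB12Run P N M) where
  -- further restrictions on the constants (p07's `Lemma4Data`, `Cπ = 2`)
  hB : 1 ≤ lam.consts.B₃
  hY : 1 ≤ lam.consts.B₃ ^ 2 * lam.consts.O₁ * lam.consts.M
  hα₁ : 16 * (lam.consts.O₁ * lam.consts.M * lam.consts.α₁) ≤ lam.consts.β
  hL10 : 1 + 10 * lam.consts.β ≤ lam.consts.L ^ 2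
  hB'' : 0 ≤ lam.B₃''
  hres'' : lam.B₃'' * lam.consts.α₃ ≤ lam.consts.β * lam.consts.L⁻¹ ^ 2 * lam.consts.α₀
  hresJ : 4 * ((P.d - 1) * ((2 : ℝ) * C311 1)) * (lam.consts.B₃ ^ 2 * lam.consts.O₁ * lam.consts.M) ^ 2 * lam.consts.α₀ ≤ lam.consts.β
  -- the fundamental case: `X ⊂ Y = □̃³`, `X̃⁻² ⊂ X`, `X, Y ⊂ (□₀)^{∼−2}` read on plaquettes ∕ bonds ∕ derivative stencils
  hXb : (lam.frameX Rz).X.bonds ⊆ lam.regionY.bonds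
  hXd : (lam.frameX Rz).X.dpairs ⊆ lam.regionY.dpairs
  hX₂b : (lam.frameX Rz).X₂.bonds ⊆ lam.regionY.bonds
  hX₂p : (lam.frameX Rz).X₂.plaqs ⊆ (lam.frameX Rz).X.plaqs
  hXp' : (lam.frameX Rz).X.plaqs ⊆ (lam.frameBox Rz).X₂.plaqs
  hYb' : lam.regionY.bonds ⊆ (lam.frameBox Rz).X₂.bonds
  hXp : ∀ p ∈ (lam.frameX Rz).X.plaqs, (⟨p.src, p.μ⟩ : PBond P 0) ∈ lam.regionY.bonds ∧ (⟨p.src.shift p.μ, p.ν⟩ : PBond P 0) ∈ lam.regionY.bonds ∧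
    (⟨p.src.shift p.ν, p.μ⟩ : PBond P 0) ∈ lam.regionY.bonds ∧ (⟨p.src, p.ν⟩ : PBond P 0) ∈ lam.regionY.bonds ∧
    (p.src, p.μ, p.ν) ∈ lam.regionY.dpairs ∧ (p.src, p.ν, p.μ) ∈ lam.regionY.dpairs
  -- the by-reference package on the printed domain
  inputs : ∀ (Φ : FieldPair P 0 (MatA N)ˣ (MatA N)) (A : PBond P 0 → MatA N) (τ : ℝ) (B' : PBond P 0 → MatA N),
    Φ ∈ space (suModel N) (lam.frameBox Rz) (lam.csBox cB) ((1 + 2 * lam.consts.β) * lam.consts.α₀) ((1 + 2 * lam.consts.β) * lam.consts.α₁) lam.α₀ →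
      A ∈ lam.A331 → 0 ≤ τ → τ ≤ 1 → ‖B'‖ < lam.consts.α₃ →
        JInputs (suModel N) lam.consts (lam.frameX Rz) (lam.frameBox Rz) (lam.csX cB) (lam.csBox cB) lam.regionY (slProj N) lam.idx.η lam.B₃'' lam.α₀
          lam.idx.j τ ‖B'‖ (lam.K Φ A τ) (lam.A₂ Φ A τ B')
  -- analyticity of the letters along analytic families with values in the domain
  hKan : ∀ {E : Type} [NormedAddCommGroup E] [NormedSpace ℂ E] {Φf : E → FieldPair P 0 (MatA N)ˣ (MatA N)} {Af Bf : E → PBond P 0 → MatA N}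
    {e₀ : E} (τ : ℝ), LettersAnalyticAt Φf Af Bf e₀ →
      Φf e₀ ∈ space (suModel N) (lam.frameBox Rz) (lam.csBox cB) ((1 + 2 * lam.consts.β) * lam.consts.α₀) ((1 + 2 * lam.consts.β) * lam.consts.α₁) lam.α₀ →
        Af e₀ ∈ lam.A331 → 0 ≤ τ → τ ≤ 1 → ‖Bf e₀‖ < lam.consts.α₃ → ∀ b, AnalyticAt ℂ (fun e => lam.K (Φf e) (Af e) τ b) e₀
  hA2an : ∀ {E : Type} [NormedAddCommGroup E] [NormedSpace ℂ E] {Φf : E → FieldPair P 0 (MatA N)ˣ (MatA N)} {Af Bf : E → PBond P 0 → MatA N}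
    {e₀ : E} (τ : ℝ), LettersAnalyticAt Φf Af Bf e₀ →
      Φf e₀ ∈ space (suModel N) (lam.frameBox Rz) (lam.csBox cB) ((1 + 2 * lam.consts.β) * lam.consts.α₀) ((1 + 2 * lam.consts.β) * lam.consts.α₁) lam.α₀ →
        Af e₀ ∈ lam.A331 → 0 ≤ τ → τ ≤ 1 → ‖Bf e₀‖ < lam.consts.α₃ → ∀ b, AnalyticAt ℂ (fun e => lam.A₂ (Φf e) (Af e) τ (Bf e) b) e₀

/-- `0 < L` (real) for the torus parameters. [cite: Balaban1987RG1, §0 p.251 (bookkeeping)] -/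
private theorem L_real_pos : 0 < (P.L : ℝ) := Nat.cast_pos.mpr P.L_pos

/-- `1 ≤ L` (real). [cite: Balaban1987RG1, §0 p.251 (bookkeeping)] -/
private theorem one_le_L_real : 1 ≤ (P.L : ℝ) := by exact_mod_cast P.L_pos

/-- `0 < η_k = L⁻ᵏ`. [cite: Balaban1987RG1, (1.2) p.260 (bookkeeping)] -/
private theorem eta_pos' (k : ℕ) : 0 < P.eta k := pow_pos (inv_pos.mpr (L_real_pos (P := P))) k

/-- `η_k ≤ 1`. [cite: Balaban1987RG1, (1.2) p.260 (bookkeeping)] -/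
private theorem eta_le_one (k : ℕ) : P.eta k ≤ 1 := pow_le_one₀ (inv_nonneg.mpr (L_real_pos (P := P)).le) (inv_le_one_of_one_le₀ one_le_L_real)

/-- `Lᵏ · η_k = 1`. [cite: Balaban1987RG1, (1.2) p.260 (bookkeeping)] -/
private theorem L_pow_mul_eta (k : ℕ) : (P.L : ℝ) ^ k * P.eta k = 1 := by
  rw [Params.eta, ← mul_pow, mul_inv_cancel₀ (Sect2.L_cast_ne_zero P), one_pow]

/-- `η_{k+1} = L⁻¹ · η_k`. [cite: Balaban1987RG1, (1.2) p.260 (bookkeeping)] -/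
private theorem eta_succ (k : ℕ) : P.eta (k + 1) = (P.L : ℝ)⁻¹ * P.eta k := by
  rw [Params.eta, Params.eta, pow_succ, mul_comm]

/-- `Lʲ · η_k ≤ 1` for `j ≤ k`. [cite: Balaban1987RG1, p.279 («j ≤ k, hence Lʲη ≤ 1»)] -/
private theorem L_pow_mul_eta_le {j k : ℕ} (hjk : j ≤ k) : (P.L : ℝ) ^ j * P.eta k ≤ 1 := by
  obtain ⟨m, rfl⟩ := Nat.exists_eq_add_of_le hjk
  rw [Params.eta, pow_add, ← mul_assoc, ← mul_pow, mul_inv_cancel₀ (Sect2.L_cast_ne_zero P), one_pow, one_mul]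
  exact pow_le_one₀ (inv_nonneg.mpr (L_real_pos (P := P)).le) (inv_le_one_of_one_le₀ one_le_L_real)

/-- `η_j · (L^{j−1} · η_k) = L⁻¹ · η_k` for `1 ≤ j`. [cite: Balaban1987RG1, p.275 («ξ·L^{j−1}η = L⁻¹η»)] -/
private theorem eta_mul_scale {j : ℕ} (hj : 1 ≤ j) (k : ℕ) : P.eta j * ((P.L : ℝ) ^ (j - 1) * P.eta k) = (P.L : ℝ)⁻¹ * P.eta k := by
  obtain ⟨m, rfl⟩ := Nat.exists_eq_add_of_le hj
  rw [Nat.add_sub_cancel_left, ← mul_assoc, Params.eta, pow_add, pow_one, mul_assoc ((P.L : ℝ)⁻¹), ← mul_pow,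
    inv_mul_cancel₀ (Sect2.L_cast_ne_zero P), one_pow, mul_one]

/-- **THE BY-REFERENCE PACKAGE OF RECORD** (p07's `Lemma4Data` for the objects of record): frames, scales, `Y`, `π = slProj N`, `Cπ = 2`, `η = L⁻ᵏ`, `γ₀′ = α₀`, the class (3.31),
`|B′| = ‖B′‖`, the letters of the residual; the seventeen scale ∕ model ∕ projection law-fields PROVED for the objects of record; the rest from the displayed package.
[cite: Balaban1987RG1, Lemma 4 (3.53) p.280 with (3.26)–(3.52) pp.275–280; (1.8) p.261, (1.12) p.262] -/
def lemma4DataOfRecord (Rz : Sect2.Residual P (MatA N)) {cB : ℝ} (hcB : 0 < cB) (lam : ResidB12Run P N M) (L : B12Package Rz cB lam) :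
    Lemma4Data P 0 (suModel N) lam.consts where
  F := lam.frameX Rz
  cs := lam.csX cB
  F' := lam.frameBox Rz
  cs' := lam.csBox cB
  Y := lam.regionY
  π := slProj N
  Cπ := 2
  η := lam.idx.η
  j := lam.idx.j
  B₃'' := lam.B₃''
  γ₀' := lam.α₀
  A331 := lam.A331
  normB B' := ‖B'‖
  K := lam.K
  A₂ := lam.A₂
  hB := L.hB
  hY := L.hY
  hα₁ := L.hα₁
  hL10 := L.hL10
  hB'' := L.hB''
  hres'' := L.hres''
  hresJ := L.hresJ
  hξ := eta_pos' lam.idx.j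
  hξ1 := eta_le_one lam.idx.j
  hcB := hcB
  hL := one_le_L_real
  hLξ := L_pow_mul_eta lam.idx.j
  hη := eta_pos' lam.idx.k
  hj := lam.idx.one_le_j
  hscale := L_pow_mul_eta_le lam.idx.j_le_k
  hξx := eta_mul_scale lam.idx.one_le_j lam.idx.k
  hj' := Nat.succ_le_succ (Nat.zero_le _)
  hLξ' := L_pow_mul_eta (lam.idx.k + 1)
  hξ' := eta_succ lam.idx.k
  heGc := suModel_heGc _
  hπ := slProj_mem_suModel_gc
  hgc := suModel_hgc_Gc
  hπR := slProj_conj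
  hCπ := zero_le_two
  hπn := B12Eq311Models.norm_slProj_le
  hXb := L.hXb
  hXd := L.hXd
  hX₂b := L.hX₂b
  hX₂p := L.hX₂p
  hXp' := L.hXp'
  hYb' := L.hYb'
  hXp := L.hXp
  inputs := L.inputs
  hKan τ hLe hΦ hA hτ0 hτ1 hB' := L.hKan τ hLe hΦ hA hτ0 hτ1 hB'
  hA2an τ hLe hΦ hA hτ0 hτ1 hB' := L.hA2an τ hLe hΦ hA hτ0 hτ1 hB'

/-- p07's concrete frame of the package of record IS the frame of Lemma 4 of record (`rfl`). [cite: Balaban1987RG1, Lemma 4 (3.53) p.280 (bookkeeping)] -/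
theorem frameOf_lemma4DataOfRecord (Rz : Sect2.Residual P (MatA N)) {cB : ℝ} (hcB : 0 < cB) (lam : ResidB12Run P N M) (L : B12Package Rz cB lam) :
    frameOf (suModel N) lam.consts (lemma4DataOfRecord Rz hcB lam L) = F12OfRecord Rz cB lam := rfl

/-- **THE KNIT FACE — LEMMA 4 (3.53) AT THE GROUP OF RECORD FROM THE DISPLAYED PACKAGE**: lit-balaban p07's `lemma4Printed_frameOf` BY NAME on the package of record
(membership by `B12Lemma4Assembled.ofBackground_mem_space'_lemma4_of_upper_space`, analyticity by `B12CondIIIJConcreteModels.analyticAt_pair_lemma4`).  NOT a discharge of N09: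
the package `B12Package` is a hypothesis. [cite: Balaban1987RG1, Lemma 4 (3.53) p.280] -/
theorem b12LeafOfRecord_of_package [NeZero N] (Rz : Sect2.Residual P (MatA N)) {cB : ℝ} (hcB : 0 < cB) (lam : ResidB12Run P N M)
    (L : B12Package Rz cB lam) : B12LeafOfRecord Rz cB lam := by
  rw [B12LeafOfRecord, ← frameOf_lemma4DataOfRecord Rz hcB lam L]
  exact lemma4Printed_frameOf _

end Package

/-! ## §B. At a Stage-11 parameter and at a record of `IsRecordOfRecord₁₁CB10YZWB8B12` -/

section Record

variable (F : T4Family) (N : ℕ) [NeZero N]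

/-- **The knit face at a Stage-11 parameter**: admissibility (`0 < O(1)LMB`) and the displayed package give the leaf (`b12LeafOfRecord_of_package`).
[cite: Balaban1987RG1, Lemma 4 (3.53) p.280] -/
theorem b12LeafOfRecord₁₁_of_package (θ : Stage11Params F N) (hθ : θ.Admissible) (lam : ResidB12 F N θ.τ9.M) (p : B12.RunParams)
    (L : B12Package (θ.Rz p.K) θ.s2.cB (lam p)) : B12LeafOfRecord₁₁ F N θ lam p :=
  b12LeafOfRecord_of_package (θ.Rz p.K) hθ.pos.1 (lam p) L

variable {F N}
variable {D : FiniteEpsData F (SU N)} {w : WorldP}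

/-- **The package-form of the same**: a displayed package `B12Package` at every presenting parameter package gives `b12` at every run of the record.
[cite: Balaban1987RG1, Lemma 4 (3.53) p.280] -/
theorem b12_leaf_of_isRecordOfRecord₁₁CB10YZWB8B12_of_package (h : IsRecordOfRecord₁₁CB10YZWB8B12 F N D w)
    (hL : ∀ (θ : Stage11Params F N) (hP : θ.Provisos₁₁) (lam12 : ResidB12 F N θ.τ9.M), θ.Admissible → D = datumOfRecord₁₁ F N θ hP →
      ∀ P, B12Package (θ.Rz P.K) θ.s2.cB (lam12 P))
    (P : B12.RunParams) : (leavesP w P).b12 :=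
  b12_leaf_of_isRecordOfRecord₁₁CB10YZWB8B12_of_slots h
    (fun θ hP lam12 _ _ _ _ _ hθ hD _ P => b12LeafOfRecord₁₁_of_package F N θ hθ lam12 P (hL θ hP lam12 hθ hD P)) P

end Record

end Literature.MathematicalPhysics.QuantumFieldTheory.Balaban1983to89.Node00

end
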